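import Summits.Ventures.QEC.Census.CertScanSplit
import Summits.Ventures.QEC.Census.HB.HB90a.BZData
import HarnessLib

/-!
# `HB90a` — `bz` certificate, side Z: ENUMERATION verdicts 1/3, tier KERNEL (CERTIFIED: decide +kernel; axioms ⊆ {propext, Classical.choice, Quot.sound})

For each (block `b`, matrix `i`) listed: `cert.bzZEnum bzData b i = true` by `native_decide` — the
Brouwer–Zimmermann replay of matrix `i` of block `b`: every codeword `u · G_i` with `1 ≤ |u| ≤ t_i` has weight
`> wmax` or is allow-listed (CERT-FORMAT C4 / C17 (7)); tactic `decide +kernel`. KERNEL tier: each matrix ≲ 4·10⁵ codewords (type-10 22:34:29Z: 1–6·10³ visits/s in the kernel); `set_option maxHeartbeats 1000000` per theorem because one matrix exceeds the default deterministic budget of the kernel (qec-search-7: BB90 matrix of 1.6·10⁵ codewords timed out at 200000), memory guard untouched.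
Structure (`BZStructZ`), information sets (`BZInfoSetsZ*`) and bounds (`BZBoundsZ`) are KERNEL files.
-/

namespace Summit.Ventures.QEC.Census.HB90a

set_option maxHeartbeats 1000000 in
/-- Block 0, matrix 0: the BZ enumeration verdict (`decide +kernel`; 15226 codewords). -/
theorem enumZ_0_0 : HB90a.cert.bzZEnum HB90a.bzData 0 0 = true := by
  decide +kernel

set_option maxHeartbeats 1000000 in
/-- Block 0, matrix 1, first rows 0 … 2 (budget 3 after the first row; 39907 codewords): pass (`decide +kernel`). -/
theorem enumZ_0_1_r0 : chunk1R (HB90a.cert.bzTestZ) (HB90a.cert.bzPosZ HB90a.bzData 0 1) 3 0 3 = true := by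
  decide +kernel

set_option maxHeartbeats 1000000 in
/-- Block 0, matrix 1, first rows 3 … 7 (budget 3 after the first row; 49795 codewords): pass (`decide +kernel`). -/
theorem enumZ_0_1_r3 : chunk1R (HB90a.cert.bzTestZ) (HB90a.cert.bzPosZ HB90a.bzData 0 1) 3 3 5 = true := by
  decide +kernel

set_option maxHeartbeats 1000000 in
/-- Block 0, matrix 1, first rows 8 … 15 (budget 3 after the first row; 46678 codewords): pass (`decide +kernel`). -/
theorem enumZ_0_1_r8 : chunk1R (HB90a.cert.bzTestZ) (HB90a.cert.bzPosZ HB90a.bzData 0 1) 3 8 8 = true := by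
  decide +kernel

set_option maxHeartbeats 1000000 in
/-- Block 0, matrix 1, first rows 16 … 44 (budget 3 after the first row; 27840 codewords): pass (`decide +kernel`). -/
theorem enumZ_0_1_r16 : chunk1R (HB90a.cert.bzTestZ) (HB90a.cert.bzPosZ HB90a.bzData 0 1) 3 16 29 = true := by
  decide +kernel

/-- Block 0, matrix 1: the BZ enumeration verdict, ASSEMBLED from its 4 first-row ranges. -/
theorem enumZ_0_1 : HB90a.cert.bzZEnum HB90a.bzData 0 1 = true :=
  HB90a.cert.bzZEnum_of_scan HB90a.bzData 0 1 (scan_origin_eq_true_of_chunk1 45 (by decide +kernel) (by decide +kernel)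
    (forall_lt_append (forall_lt_append (forall_lt_append (forall_lt_append (forall_lt_zero) (forall_of_chunk1R enumZ_0_1_r0)) (forall_of_chunk1R enumZ_0_1_r3)) (forall_of_chunk1R enumZ_0_1_r8)) (forall_of_chunk1R enumZ_0_1_r16)))

end Summit.Ventures.QEC.Census.HB90a
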